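import Summits.MatrixMultiplication.MatrixMultiplication.Theorems.ObstructionDescentUnitStep

set_option linter.dupNamespace false

/-!
# The unit-step law on the whole frame family `⟨m⟩ + u ⊗ v ⊗ w` (decomp-mm · lens 3 · gen 14, Part G2)

Route `route-MatrixMultiplication-ObstructionDescent`, support for the aside `InvariantSaturation` (item
`stmt-MatrixMultiplication-32282`); a corollary sheet of `ObstructionDescentUnitStep`.

`ObstructionDescentUnitStep` proves that for ODD `k` with `k + 2 ≤ m` every weight vector of the rectangular type
`((k^m),(k^m),(k^m))` vanishes at the STEP POINTS `⟨m⟩ + 𝟙⊗𝟙⊗z`.  Here the statement is moved to the natural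
family: the FRAME POINTS `framePoint u v w = ⟨m⟩ + u⊗v⊗w` with `u`, `v` off the coordinate hyperplanes
(`∀ a, u a ≠ 0`, `∀ b, v b ≠ 0`; `w` arbitrary).  The diagonal element
`(diag(u)⁻¹, diag(v)⁻¹, diag(u·v)) ∈ GL_m³` fixes `⟨m⟩` and carries `framePoint u v w` to the step point with
`z = u·v·w` (`actTensor_diagonal_framePoint`), so by `GL_m³`-invariance of the level set at the first cell
(`pointLevels_self_actTensor`) the level-`k` weight vectors vanish at every frame point and on its whole
`GL_m³`-orbit (`evalT_framePoint_eq_zero`, `not_mem_pointLevels_framePoint`,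
`not_mem_pointLevels_actTensor_framePoint`).  Informally: every tensor `Σ_{i<m} aᵢ⊗bᵢ⊗cᵢ + a′⊗b′⊗c′` with
`(aᵢ)`, `(bᵢ)`, `(cᵢ)` bases and `a′`, `b′` having no zero coordinate in them is such an orbit point, and these
form a dense subset of the `(m+1)`-st secant variety; for `m = 5`, `k = 3` this is the kernel form of
«`H₅ ∈ I(σ₆(5³))`» on that dense family (density itself is not formalised).  All hypotheses inline; no `sorry`;
standard axioms.  Nothing here proves `ω = 2`.
[cite: BurgisserIkenmeyer2011, §3.1–3.2; BurgisserIkenmeyer2017, §5 (5.2), Thm 5.3]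
-/

noncomputable section

open scoped BigOperators
open Finset

namespace Summit.MatrixMultiplication.MatrixMultiplication.Theorems.ObstructionCalculus

open Literature.Computability.AlgebraicComplexity (actTensor unitTensor unitTensor_apply)

section UnitStepFrame

variable {m : ℕ}

/-- The FRAME POINT `⟨m⟩ + u ⊗ v ⊗ w`. [this node] -/
def framePoint (u v w : Fin m → ℂ) : Tensor ℂ m := fun a b c => unitTensor ℂ m a b c + u a * v b * w c

/-- A diagonal matrix with non-zero diagonal is invertible. [bookkeeping] -/
theorem det_diagonal_ne_zero {δ : Fin m → ℂ} (h : ∀ i, δ i ≠ 0) : (Matrix.diagonal δ).det ≠ 0 := by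
  rw [Matrix.det_diagonal]
  exact Finset.prod_ne_zero_iff.2 fun i _ => h i

/-- The diagonal element `(diag(u)⁻¹, diag(v)⁻¹, diag(u·v))` carries the frame point `⟨m⟩ + u⊗v⊗w` to the step point
`⟨m⟩ + 𝟙⊗𝟙⊗(u·v·w)`. [this node] -/
theorem actTensor_diagonal_framePoint (u v w : Fin m → ℂ) (hu : ∀ a, u a ≠ 0) (hv : ∀ b, v b ≠ 0) :
    actTensor (Matrix.diagonal fun a => (u a)⁻¹) (Matrix.diagonal fun b => (v b)⁻¹)
        (Matrix.diagonal fun c => u c * v c) (framePoint u v w)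
      = stepPoint fun c => u c * v c * w c := by
  rw [actTensor_diagonal]
  funext a b c
  simp only [framePoint, stepPoint, unitTensor_apply]
  by_cases h : a = b ∧ b = c
  · obtain ⟨rfl, rfl⟩ := h
    rw [if_pos ⟨rfl, rfl⟩]
    calc (u a)⁻¹ * (v a)⁻¹ * (u a * v a) * (1 + u a * v a * w a)
        = ((u a)⁻¹ * u a) * ((v a)⁻¹ * v a) * (1 + u a * v a * w a) := by ring
      _ = 1 + u a * v a * w a := by rw [inv_mul_cancel₀ (hu a), inv_mul_cancel₀ (hv a), one_mul, one_mul]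
  · rw [if_neg h, zero_add, zero_add]
    calc (u a)⁻¹ * (v b)⁻¹ * (u c * v c) * (u a * v b * w c)
        = ((u a)⁻¹ * u a) * ((v b)⁻¹ * v b) * (u c * v c * w c) := by ring
      _ = u c * v c * w c := by rw [inv_mul_cancel₀ (hu a), inv_mul_cancel₀ (hv b), one_mul, one_mul]

/-- **Unit-step law on the frame family (level set).**  For ODD `k` with `k + 2 ≤ m`, `k ∉ E'_m(⟨m⟩ + u⊗v⊗w)`
whenever `u`, `v` have no zero coordinate. [this node] -/
theorem not_mem_pointLevels_framePoint {k : ℕ} (hk : Odd k) (hkm : k + 2 ≤ m) (u v w : Fin m → ℂ)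
    (hu : ∀ a, u a ≠ 0) (hv : ∀ b, v b ≠ 0) : k ∉ pointLevels m (framePoint u v w) := by
  rw [← pointLevels_self_actTensor (det_diagonal_ne_zero fun a => inv_ne_zero (hu a))
      (det_diagonal_ne_zero fun b => inv_ne_zero (hv b)) (det_diagonal_ne_zero fun c => mul_ne_zero (hu c) (hv c))
      (framePoint u v w), actTensor_diagonal_framePoint u v w hu hv]
  exact not_mem_pointLevels_stepPoint hk hkm _

/-- **Unit-step law on the frame family (values).**  Every level-`k` weight vector (degree `k·m`) vanishes at
`⟨m⟩ + u⊗v⊗w`. [this node] -/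
theorem evalT_framePoint_eq_zero {k : ℕ} (hk : Odd k) (hkm : k + 2 ≤ m) {f : MvPolynomial (Idx m) ℂ}
    (hf : f ∈ hwvSpace (rectType m m k) (k * m)) (u v w : Fin m → ℂ) (hu : ∀ a, u a ≠ 0) (hv : ∀ b, v b ≠ 0) :
    evalT (framePoint u v w) f = 0 := by
  by_contra hne
  exact not_mem_pointLevels_framePoint hk hkm u v w hu hv ⟨f, hf, hne⟩

/-- … and on the whole `GL_m³`-orbit of every frame point — a dense family in the `(m+1)`-st secant variety; for
`m = 5`, `k = 3` the kernel form of «`H₅ ∈ I(σ₆(5³))`» there. [this node] -/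
theorem not_mem_pointLevels_actTensor_framePoint {k : ℕ} (hk : Odd k) (hkm : k + 2 ≤ m)
    {A B C : Matrix (Fin m) (Fin m) ℂ} (hA : A.det ≠ 0) (hB : B.det ≠ 0) (hC : C.det ≠ 0) (u v w : Fin m → ℂ)
    (hu : ∀ a, u a ≠ 0) (hv : ∀ b, v b ≠ 0) : k ∉ pointLevels m (actTensor A B C (framePoint u v w)) := by
  rw [pointLevels_self_actTensor hA hB hC]
  exact not_mem_pointLevels_framePoint hk hkm u v w hu hv

end UnitStepFrame

end Summit.MatrixMultiplication.MatrixMultiplication.Theorems.ObstructionCalculus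

end
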